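import Mathlib
import HarnessLib
import Summits.Ventures.LatticeQCDFlow.Scoring.ScalingExponentFit

/-!
# The fitted scaling exponent is a weighted mean of the two-point exponents: `z = Σ_{i<j} wᵢwⱼ(xᵢ − xⱼ)² z_{ij} / Σ_{i<j} wᵢwⱼ(xᵢ − xⱼ)²`, so it lies between the smallest and the largest two-point exponent

HONEST FRAMING: exact (Metropolis-corrected) sampling algorithms for lattice gauge theory;
figures of merit are autocorrelation/cost numbers at stated couplings and volumes; no
continuum-physics claim.

Venture `LatticeQCDFlow` (cell pub-lqcd), sub-topic `Scoring`, FANOUT row 21 (`su3-base`).  Acceptance item (g) of the row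
reports BOTH the fitted exponent `z` of `τ_int(Q²) ∝ x^z` over (P0, S2, P1) AND the two-point exponents of consecutive pairs
(HOME/su3-base/CARD-su3-base.md §7 (g); the fit is the weighted log–log least-squares slope typed by row 7's
`Scoring/ScalingExponentFit`: `fitSlope s w x y = (S₀S_xy − SₓS_y)/Δ`, `two_mul_fitDet : 2Δ = Σᵢⱼ wᵢwⱼ(xᵢ − xⱼ)²`).
This file adds the companion Lagrange identity for the NUMERATOR and its consequence — OUR WORK, finite real algebra over
Mathlib and that file; no definition, nothing cited as a fact, no number:

* **`two_mul_fitNum`** — `2(S₀S_xy − SₓS_y) = Σᵢ Σⱼ wᵢwⱼ(xᵢ − xⱼ)(yᵢ − yⱼ)`.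
* **`fitSlope_eq_pairwise`** — `fitSlope = (Σᵢⱼ wᵢwⱼ(xᵢ − xⱼ)(yᵢ − yⱼ)) / (Σᵢⱼ wᵢwⱼ(xᵢ − xⱼ)²)`: the fitted slope is the mean of the
  PAIRWISE slopes `z_{ij} = (yᵢ − yⱼ)/(xᵢ − xⱼ)` with the non-negative weights `wᵢwⱼ(xᵢ − xⱼ)²` (pairs with equal abscissae weigh
  nothing) — every number of points, every non-negative weights.
* **`fitSlope_mem_Icc_of_pairwise`** — THE BRACKET: with non-negative weights and `Δ > 0`, if every pair with `xᵢ ≠ xⱼ` has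
  `m ≤ z_{ij} ≤ M` then `m ≤ fitSlope ≤ M`.  For the row's three points: the reported fit exponent necessarily lies between the
  smallest and the largest of the three two-point exponents (take `m`, `M` = their min / max; a consistency check of the (g)
  table that costs nothing); with
  row 21's `Scaling/ExponentialLawSecantExponent` (two-point exponents of an exponential law increase along the scale axis) the
  fit of an exponential law by a power sits strictly inside the spread of its two-point exponents.
NOT CLAIMED: anything statistical (the weights' meaning, error bars — `Scaling/SecantExponentErrorBar`); which law holds.
-/

noncomputable section

namespace Summit.Ventures.LatticeQCDFlow.Scoring

open Finset

variable {ι : Type*} (s : Finset ι) (w x y : ι → ℝ)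

/-- **Lagrange's identity for the numerator**: `2(S₀S_xy − SₓS_y) = Σᵢ Σⱼ wᵢwⱼ(xᵢ − xⱼ)(yᵢ − yⱼ)`. -/
theorem two_mul_fitNum :
    2 * (fitS0 s w * fitSxy s w x y - fitSx s w x * fitSy s w y) =
      ∑ i ∈ s, ∑ j ∈ s, w i * w j * ((x i - x j) * (y i - y j)) := by
  have e1 : fitS0 s w * fitSxy s w x y = ∑ i ∈ s, ∑ j ∈ s, w i * (w j * (x j * y j)) := by
    rw [fitS0, fitSxy, Finset.sum_mul_sum]
  have e1' : fitSxy s w x y * fitS0 s w = ∑ i ∈ s, ∑ j ∈ s, w i * (x i * y i) * w j := by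
    rw [fitS0, fitSxy, Finset.sum_mul_sum]
  have e2 : fitSx s w x * fitSy s w y = ∑ i ∈ s, ∑ j ∈ s, w i * x i * (w j * y j) := by
    rw [fitSx, fitSy, Finset.sum_mul_sum]
  have e2' : fitSy s w y * fitSx s w x = ∑ i ∈ s, ∑ j ∈ s, w i * y i * (w j * x j) := by
    rw [fitSx, fitSy, Finset.sum_mul_sum]
  have h : 2 * (fitS0 s w * fitSxy s w x y - fitSx s w x * fitSy s w y) =
      fitS0 s w * fitSxy s w x y + fitSxy s w x y * fitS0 s w -
        (fitSx s w x * fitSy s w y + fitSy s w y * fitSx s w x) := by ring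
  rw [h, e1, e1', e2, e2', ← Finset.sum_add_distrib, ← Finset.sum_add_distrib, ← Finset.sum_sub_distrib]
  refine Finset.sum_congr rfl fun i _ => ?_
  rw [← Finset.sum_add_distrib, ← Finset.sum_add_distrib, ← Finset.sum_sub_distrib]
  exact Finset.sum_congr rfl fun j _ => by ring

/-- **THE FITTED SLOPE IS THE WEIGHTED MEAN OF THE PAIRWISE SLOPES**:
`fitSlope = (Σᵢⱼ wᵢwⱼ(xᵢ − xⱼ)(yᵢ − yⱼ)) / (Σᵢⱼ wᵢwⱼ(xᵢ − xⱼ)²)` (both sides have the junk value `0` when `Δ = 0`). -/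
theorem fitSlope_eq_pairwise :
    fitSlope s w x y = (∑ i ∈ s, ∑ j ∈ s, w i * w j * ((x i - x j) * (y i - y j))) /
      (∑ i ∈ s, ∑ j ∈ s, w i * w j * (x i - x j) ^ 2) := by
  rw [← two_mul_fitNum, ← two_mul_fitDet, fitSlope, mul_div_mul_left _ _ (two_ne_zero)]

/-- **THE BRACKET: `m ≤ fitSlope ≤ M`** whenever the weights are non-negative, `Δ > 0`, and every pair of points with distinct
abscissae has two-point slope `(yᵢ − yⱼ)/(xᵢ − xⱼ) ∈ [m, M]`. -/
theorem fitSlope_mem_Icc_of_pairwise (hw : ∀ i ∈ s, 0 ≤ w i) (hD : 0 < fitDet s w x) {m M : ℝ}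
    (hlo : ∀ i ∈ s, ∀ j ∈ s, x i ≠ x j → m ≤ (y i - y j) / (x i - x j))
    (hhi : ∀ i ∈ s, ∀ j ∈ s, x i ≠ x j → (y i - y j) / (x i - x j) ≤ M) :
    m ≤ fitSlope s w x y ∧ fitSlope s w x y ≤ M := by
  have hden : 0 < ∑ i ∈ s, ∑ j ∈ s, w i * w j * (x i - x j) ^ 2 := by
    rw [← two_mul_fitDet]; linarith
  -- each pair's numerator term is bracketed by `m`, `M` times its weight
  have key : ∀ i ∈ s, ∀ j ∈ s,
      m * (w i * w j * (x i - x j) ^ 2) ≤ w i * w j * ((x i - x j) * (y i - y j)) ∧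
        w i * w j * ((x i - x j) * (y i - y j)) ≤ M * (w i * w j * (x i - x j) ^ 2) := by
    intro i hi j hj
    have hwij : 0 ≤ w i * w j := mul_nonneg (hw i hi) (hw j hj)
    by_cases hx : x i = x j
    · simp [hx]
    · have hd : x i - x j ≠ 0 := sub_ne_zero.2 hx
      have hsq : 0 < (x i - x j) ^ 2 := by positivity
      have e : (x i - x j) * (y i - y j) = (x i - x j) ^ 2 * ((y i - y j) / (x i - x j)) := by
        field_simp
      rw [e]
      constructor
      · have := mul_le_mul_of_nonneg_left (hlo i hi j hj hx) (mul_nonneg hwij hsq.le)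
        nlinarith
      · have := mul_le_mul_of_nonneg_left (hhi i hi j hj hx) (mul_nonneg hwij hsq.le)
        nlinarith
  have hsum_lo : m * ∑ i ∈ s, ∑ j ∈ s, w i * w j * (x i - x j) ^ 2 ≤
      ∑ i ∈ s, ∑ j ∈ s, w i * w j * ((x i - x j) * (y i - y j)) := by
    rw [Finset.mul_sum]
    refine Finset.sum_le_sum fun i hi => ?_
    rw [Finset.mul_sum]
    exact Finset.sum_le_sum fun j hj => (key i hi j hj).1
  have hsum_hi : ∑ i ∈ s, ∑ j ∈ s, w i * w j * ((x i - x j) * (y i - y j)) ≤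
      M * ∑ i ∈ s, ∑ j ∈ s, w i * w j * (x i - x j) ^ 2 := by
    rw [Finset.mul_sum]
    refine Finset.sum_le_sum fun i hi => ?_
    rw [Finset.mul_sum]
    exact Finset.sum_le_sum fun j hj => (key i hi j hj).2
  rw [fitSlope_eq_pairwise]
  exact ⟨(le_div_iff₀ hden).2 hsum_lo, (div_le_iff₀ hden).2 hsum_hi⟩

end Summit.Ventures.LatticeQCDFlow.Scoring
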